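import Mathlib
import Summits.ValiantsHypothesis.ValiantsHypothesis.Theorems.BarrierLeverPartitionMinorsHitByVPHiddenStatesBall

/-!
# Route BarrierLever — item `PartitionMinorsHitByVP` (stmt-ValiantsHypothesis-19717):
# Conjecture Q\* FAILS at `K = h` — the STAR OBSTRUCTION (`¬ BallGood 6 6 12 star`)

Helper file (`--supports stmt-ValiantsHypothesis-19717`; cell valiant-natproofs, rung V4, 𝒟-side of door (c); prover seat
val-np-p3 gen 7). Explicit counterexample data and the numeric linear algebra of one `12 × 12` matrix; closes NO item.

The door of record `partitionMinorsHitByVP_of_ballGood` (`…HiddenStatesBall`) assumes `∀ h ≥ h₁, ∀ r u, BallGood h h r u`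
(Conjecture Q\* with EXACTLY `K = h` hidden states; verified by the cell exhaustively for `h ≤ 5` and by random sampling for
`h ≤ 9`). This file proves `¬ BallGood 6 6 12 starU`: for `h = K = 6` the column family
`starU = {∅, {0},…,{5}, {0,1},…,{0,5}}` (a 5-star on top of all singletons) has a singular additive matrix against the
ball–colex family `starE = {∅, {0},…,{5}, 01, 02, 12, 03, 13}` for EVERY table.

MECHANISM (the star obstruction; the same argument works verbatim for every `h ≥ 6` with `K = h`, `r = h + 6`). Write
`ℓ_a = c_a + λ_a` (constant + linear part on the hidden cube). The rows `{0,b}` are `ℓ_0 ℓ_b`; modulo affine functions on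
the hidden points, `ℓ_0 ℓ_b ≡ Σ_{J ∈ C} (λ_0 ⊙ λ_b)_J ε^J` with `C` the five hidden pairs, and `x ↦ (λ_0 ⊙ x)|_C` factors
through the FOUR states `{0,1,2,3}` carrying `C` (`starΦ = starN · starL`, `starL` has a zero row), so some `β ≠ 0` gives
`g = Σ β_b ℓ_b` with `ℓ_0 · g` AFFINE on the hidden points (`sum_srow_eq_affine`: cross terms on `C` vanish, pairs outside the
family vanish, squares `ε_q² = ε_q` are linear). With `K = h` the `h + 1` affine rows `∅, {b}` already exhaust the affine
functions (or are themselves dependent), so the twelve rows are dependent (`det_starM_eq_zero`, three cases).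

CONSEQUENCES (cell record): Q\* needs `K(h) > h`; seat numerics (census/star_obstruction.py) give the minimal good `K` for the
star/biclique families as `7, 9, 11` at `h = 6, 7, 8` (stars force `K ≥ 2h − 4`; bicliques `K_{s,h−s}` suggest `K ≳ h^{3/2}`
asymptotically). The variable-`K` arrow `partitionMinorsHitByVP_of_ballGood'` (`K(h) ≤ h·h`) is unaffected and is now the
door of record. WHAT THIS IS NOT: no statement about `K > h`; nothing on CPM, crux 14610 or VP ≠ VNP.
-/

set_option linter.dupNamespace false

namespace Summit.ValiantsHypothesis.ValiantsHypothesis.Theorems.BarrierLever.HiddenStates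

open Finset Matrix

noncomputable section

/-- Column family of the star counterexample (`h = 6`, `r = 12`): `∅`, the six singletons, the 5-star `01,…,05`. -/
def starU : Fin 12 → Finset (Fin 6) :=
  ![∅, {0}, {1}, {2}, {3}, {4}, {5}, {0, 1}, {0, 2}, {0, 3}, {0, 4}, {0, 5}]

/-- The ball–colex hidden family of size `12` on `K = 6` states: `∅`, the six singletons, `01, 02, 12, 03, 13`. -/
def starE : Fin 12 → Finset (Fin 6) :=
  ![∅, {0}, {1}, {2}, {3}, {4}, {5}, {0, 1}, {0, 2}, {1, 2}, {0, 3}, {1, 3}]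

/-- The column family is injective. -/
theorem starU_injective : Function.Injective starU := by
  unfold starU; decide

/-- The hidden family is injective. -/
theorem starE_injective : Function.Injective starE := by
  unfold starE; decide

/-- `starE` is a threshold family for the ball–colex weight (it consists of the 12 lightest subsets). -/
theorem starE_threshold (J : Finset (Fin 6)) (hJ : J ∉ Set.range starE) (i : Fin 12) :
    ∑ k ∈ starE i, ballWt 6 k < ∑ k ∈ J, ballWt 6 k := by
  have hJ' : ∀ i, starE i ≠ J := fun i h => hJ ⟨i, h⟩
  revert i
  revert hJ'
  revert J
  unfold starE ballWt
  decide

/-! ## 2. The additive matrix of the star family is singular for every table -/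

section Det

variable (tx : Option (Fin 6) → Fin 6 → ℂ)

/-- Constants `c_a` of the affine functionals. -/
def sc (a : Fin 6) : ℂ := tx none a
/-- Linear coefficients `λ_{a,q}`. -/
def sl (a q : Fin 6) : ℂ := tx (some q) a
/-- Values `ℓ_a(e k)`. -/
def sv (a : Fin 6) (k : Fin 12) : ℂ := sc tx a + ∑ q ∈ starE k, sl tx a q

/-- The numeric additive matrix of the star family. -/
def starM : Matrix (Fin 12) (Fin 12) ℂ :=
  Matrix.of fun i k => ∏ a ∈ starU i, (tx none a + ∑ q ∈ starE k, tx (some q) a)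

/-- Affine rows: index `none` = the row `∅`, `some b` = the row `{b}`. -/
def arow (o : Option (Fin 6)) : Fin 12 := Fin.castAdd 5 (Option.elim o (0 : Fin 7) Fin.succ)
/-- Star rows `{0, j+1}`, `j < 5`. -/
def srow (j : Fin 5) : Fin 12 := Fin.natAdd 7 j

/-- The row `∅` is the all-ones row. -/
theorem starM_arow_none (k : Fin 12) : starM tx (arow none) k = 1 := by
  simp [starM, arow, starU]

/-- The row `{b}` lists the values `ℓ_b`. -/
theorem starM_arow_some (b : Fin 6) (k : Fin 12) : starM tx (arow (some b)) k = sv tx b k := by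
  fin_cases b <;> simp [starM, arow, starU, sv, sc, sl, Fin.castAdd, Fin.succ]

/-- The row `{0, j+1}` lists the products `ℓ_0 ℓ_{j+1}`. -/
theorem starM_srow (j : Fin 5) (k : Fin 12) : starM tx (srow j) k = sv tx 0 k * sv tx j.succ k := by
  fin_cases j <;> simp [starM, srow, starU, sv, sc, sl, Fin.natAdd]

/-- Basis of the affine functions on the hidden points: `𝟙` and the indicators `χ_q`. -/
def Bv (p : Option (Fin 6)) (k : Fin 12) : ℂ := Option.elim p 1 fun q => if q ∈ starE k then 1 else 0

/-- Coefficients of the affine rows in the basis `Bv`. -/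
def Coef : Matrix (Option (Fin 6)) (Option (Fin 6)) ℂ :=
  Matrix.of fun o p => Option.elim o (Option.elim p 1 fun _ => 0) fun b => Option.elim p (sc tx b) fun q => sl tx b q

/-- Affine rows in the basis `Bv` with coefficient matrix `Coef`. -/
theorem starM_arow (o : Option (Fin 6)) (k : Fin 12) : starM tx (arow o) k = ∑ p, Coef tx o p * Bv p k := by
  rw [Fintype.sum_option]
  cases o with
  | none =>
    rw [starM_arow_none]
    simp [Coef, Bv]
  | some b =>
    rw [starM_arow_some, sv]
    simp only [Coef, Bv, Matrix.of_apply, Option.elim, mul_one, mul_ite, mul_zero]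
    rw [Finset.sum_ite_mem, Finset.univ_inter]

/-- A combination of affine rows is the affine function with coordinates `η ᵥ* Coef`. -/
theorem sum_arow (η : Option (Fin 6) → ℂ) (k : Fin 12) :
    ∑ o, η o * starM tx (arow o) k = ∑ p, (η ᵥ* Coef tx) p * Bv p k := by
  simp_rw [starM_arow, Finset.mul_sum, Matrix.vecMul, dotProduct, Finset.sum_mul]
  rw [Finset.sum_comm]
  refine Finset.sum_congr rfl fun p _ => Finset.sum_congr rfl fun o _ => by ring

/-- The factor `N` (pairs of `C` × states `0..3`, padded) and the factor `Λ` (with a zero last row). -/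
def starN : Matrix (Fin 5) (Fin 5) ℂ :=
  !![sl tx 0 1, sl tx 0 0, 0, 0, 0;
     sl tx 0 2, 0, sl tx 0 0, 0, 0;
     0, sl tx 0 2, sl tx 0 1, 0, 0;
     sl tx 0 3, 0, 0, sl tx 0 0, 0;
     0, sl tx 0 3, 0, sl tx 0 1, 0]

/-- The factor `Λ`: `λ_{j+1, x}` for the four states `x < 4`, last row zero. -/
def starL : Matrix (Fin 5) (Fin 5) ℂ :=
  Matrix.of fun x j => if h : (x : ℕ) < 4 then sl tx j.succ ⟨x, by omega⟩ else 0

/-- The symbol matrix `Φ = N · Λ` of the star rows on the hidden pairs; rank `≤ 4`. -/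
def starΦ : Matrix (Fin 5) (Fin 5) ℂ := starN tx * starL tx

/-- `det Φ = 0` (the factor `Λ` has a zero row): the symbol map has rank at most `4`. -/
theorem det_starΦ : (starΦ tx).det = 0 := by
  rw [starΦ, Matrix.det_mul]
  have : (starL tx).det = 0 := Matrix.det_eq_zero_of_row_eq_zero 4 fun j => by simp [starL]
  rw [this, mul_zero]

/-- `γ_q = Σ_j β_j λ_{j+1,q}` and `G₀ = Σ_j β_j c_{j+1}` for a kernel vector `β` of `Φ`. -/
def sγ (β : Fin 5 → ℂ) (q : Fin 6) : ℂ := ∑ j, β j * sl tx j.succ q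
/-- `G₀ = Σ_j β_j c_{j+1}`. -/
def sG (β : Fin 5 → ℂ) : ℂ := ∑ j, β j * sc tx j.succ

/-- The pair conditions: `(Φ β)_J = λ_{0q} γ_{q'} + λ_{0q'} γ_q`. -/
theorem starΦ_mulVec (β : Fin 5 → ℂ) (J : Fin 5) :
    (starΦ tx *ᵥ β) J =
      ![sl tx 0 0 * sγ tx β 1 + sl tx 0 1 * sγ tx β 0, sl tx 0 0 * sγ tx β 2 + sl tx 0 2 * sγ tx β 0,
        sl tx 0 1 * sγ tx β 2 + sl tx 0 2 * sγ tx β 1, sl tx 0 0 * sγ tx β 3 + sl tx 0 3 * sγ tx β 0,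
        sl tx 0 1 * sγ tx β 3 + sl tx 0 3 * sγ tx β 1] J := by
  fin_cases J <;>
    simp [starΦ, starN, starL, Matrix.mulVec, dotProduct, Matrix.mul_apply, Fin.sum_univ_five, sγ] <;> ring

/-- The combination `w = Σ_j β_j · (row {0, j+1})` as a product. -/
theorem sum_srow (β : Fin 5 → ℂ) (k : Fin 12) :
    ∑ j, β j * starM tx (srow j) k = sv tx 0 k * (sG tx β + ∑ q ∈ starE k, sγ tx β q) := by
  simp_rw [starM_srow]
  rw [show (∑ j, β j * (sv tx 0 k * sv tx j.succ k)) = sv tx 0 k * ∑ j, β j * sv tx j.succ k by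
    rw [Finset.mul_sum]; exact Finset.sum_congr rfl fun j _ => by ring]
  congr 1
  simp_rw [sv, sG, sγ, mul_add, Finset.sum_add_distrib, Finset.mul_sum]
  rw [Finset.sum_comm]

/-- Coordinates of the affine function `F` with `w = F`. -/
def fvec (β : Fin 5 → ℂ) (p : Option (Fin 6)) : ℂ :=
  Option.elim p (sc tx 0 * sG tx β) fun q => sc tx 0 * sγ tx β q + sG tx β * sl tx 0 q + sl tx 0 q * sγ tx β q

/-- **Key identity**: for a kernel vector `β` of `Φ`, `w = Σ_j β_j (row {0,j+1})` is the affine function with coordinates `fvec`. -/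
theorem sum_srow_eq_affine (β : Fin 5 → ℂ) (hβ : starΦ tx *ᵥ β = 0) (k : Fin 12) :
    ∑ j, β j * starM tx (srow j) k = ∑ p, fvec tx β p * Bv p k := by
  have hJ : ∀ J : Fin 5, (starΦ tx *ᵥ β) J = 0 := fun J => by rw [hβ]; rfl
  have h0 := hJ 0; have h1 := hJ 1; have h2 := hJ 2; have h3 := hJ 3; have h4 := hJ 4
  rw [starΦ_mulVec] at h0 h1 h2 h3 h4
  simp only [Matrix.cons_val_zero, Matrix.cons_val_one, Matrix.head_cons, Matrix.cons_val_two,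
    Matrix.cons_val_three, Matrix.cons_val_four, Matrix.tail_cons] at h0 h1 h2 h3 h4
  rw [sum_srow, Fintype.sum_option, sv]
  simp only [fvec, Bv, Option.elim, mul_one, mul_ite, mul_zero]
  rw [Finset.sum_ite_mem, Finset.univ_inter]
  fin_cases k <;> simp [starE]
  all_goals first
    | ring1
    | linear_combination h0
    | linear_combination h1
    | linear_combination h2
    | linear_combination h3
    | linear_combination h4

/-- The affine-row part of a sum over `Fin (7+5)` as a sum over `Option (Fin 6)`. -/
theorem sum_castAdd_eq (η : Option (Fin 6) → ℂ) (k : Fin 12) :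
    ∑ i : Fin 7, η (Fin.cases none some i : Option (Fin 6)) * starM tx (Fin.castAdd 5 i) k =
      ∑ o, η o * starM tx (arow o) k := by
  rw [Fin.sum_univ_succ, Fintype.sum_option]
  simp only [Fin.cases_zero, Fin.cases_succ]
  rfl

/-- **The additive matrix of the star family is singular for every table.** -/
theorem det_starM_eq_zero : (starM tx).det = 0 := by
  obtain ⟨β, hβ0, hβ⟩ := Matrix.exists_mulVec_eq_zero_iff.mpr (det_starΦ tx)
  have hw := sum_srow_eq_affine tx β hβ
  apply Matrix.exists_vecMul_eq_zero_iff.mp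
  by_cases hC : (Coef tx).det = 0
  · -- the seven affine rows are themselves dependent
    obtain ⟨η, hη0, hη⟩ := Matrix.exists_vecMul_eq_zero_iff.mpr hC
    refine ⟨fun i : Fin 12 => Fin.addCases (motive := fun _ => ℂ)
        (fun i : Fin 7 => η (Fin.cases none some i : Option (Fin 6))) (fun _ : Fin 5 => 0) i, ?_, ?_⟩
    · intro hz
      apply hη0
      funext o
      cases o with
      | none =>
        have := congrFun hz (Fin.castAdd 5 (0 : Fin 7))
        rw [Fin.addCases_left] at this
        simpa using this
      | some b =>
        have := congrFun hz (Fin.castAdd 5 b.succ)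
        rw [Fin.addCases_left] at this
        simpa using this
    · funext k
      change ∑ i : Fin (7 + 5), Fin.addCases (motive := fun _ => ℂ)
        (fun i : Fin 7 => η (Fin.cases none some i : Option (Fin 6))) (fun _ : Fin 5 => (0 : ℂ)) i * starM tx i k = 0
      rw [Fin.sum_univ_add]
      simp only [Fin.addCases_left, Fin.addCases_right, zero_mul, Finset.sum_const_zero, add_zero]
      rw [sum_castAdd_eq, sum_arow, hη]
      simp
  · by_cases hwz : (fun k => ∑ j, β j * starM tx (srow j) k) = 0
    · -- the star rows are themselves dependent
      refine ⟨fun i : Fin 12 => Fin.addCases (motive := fun _ => ℂ) (fun _ : Fin 7 => (0 : ℂ)) (fun j => β j) i, ?_, ?_⟩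
      · intro hz
        apply hβ0
        funext j
        have := congrFun hz (Fin.natAdd 7 j)
        rw [Fin.addCases_right] at this
        simpa using this
      · funext k
        change ∑ i : Fin (7 + 5), Fin.addCases (motive := fun _ => ℂ) (fun _ : Fin 7 => (0 : ℂ)) (fun j => β j) i *
          starM tx i k = 0
        rw [Fin.sum_univ_add]
        simp only [Fin.addCases_left, Fin.addCases_right, zero_mul, Finset.sum_const_zero, zero_add]
        exact congrFun hwz k
    · -- generic case: w is an affine function, i.e. a combination of the affine rows
      have hunit : IsUnit (Coef tx).det := isUnit_iff_ne_zero.mpr hC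
      set θ : Option (Fin 6) → ℂ := fvec tx β ᵥ* (Coef tx)⁻¹ with hθ
      have hθC : θ ᵥ* Coef tx = fvec tx β := by
        rw [hθ, Matrix.vecMul_vecMul, Matrix.nonsing_inv_mul _ hunit, Matrix.vecMul_one]
      refine ⟨fun i : Fin 12 => Fin.addCases (motive := fun _ => ℂ)
        (fun i : Fin 7 => -θ (Fin.cases none some i : Option (Fin 6))) (fun j => β j) i, ?_, ?_⟩
      · intro hz
        apply hβ0
        funext j
        have := congrFun hz (Fin.natAdd 7 j)
        rw [Fin.addCases_right] at this
        simpa using this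
      · funext k
        change ∑ i : Fin (7 + 5), Fin.addCases (motive := fun _ => ℂ)
          (fun i : Fin 7 => -θ (Fin.cases none some i : Option (Fin 6))) (fun j => β j) i * starM tx i k = 0
        rw [Fin.sum_univ_add]
        simp only [Fin.addCases_left, Fin.addCases_right, neg_mul]
        rw [Finset.sum_neg_distrib, sum_castAdd_eq, sum_arow, hθC, ← hw k]
        show -(∑ j, β j * starM tx (srow j) k) + ∑ j, β j * starM tx (Fin.natAdd 7 j) k = 0
        simp [srow]

end Det

/-! ## 3. Conjecture Q\* at `K = h` fails at `h = 6` -/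

/-- **The star family is not `BallGood 6 6 12`**: against the (unique) ball–colex threshold family of size 12 on 6 states,
no table makes the additive matrix of `∅`, the six singletons and the 5-star `{0,b}` nonsingular. Hence the hypothesis
`∀ h ≥ h₁, ∀ r u, BallGood h h r u` of `partitionMinorsHitByVP_of_ballGood` fails for `h₁ ≤ 6` (and, by the same star mechanism
recorded in the module docstring, for every `h₁`); the variable-`K` arrow `partitionMinorsHitByVP_of_ballGood'` is unaffected. -/
theorem not_ballGood_star6 : ¬ BallGood 6 6 12 starU := by
  intro hgood
  obtain ⟨tx, htx⟩ := hgood starE starE_injective starE_threshold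
  exact htx (det_starM_eq_zero tx)

end

end Summit.ValiantsHypothesis.ValiantsHypothesis.Theorems.BarrierLever.HiddenStates
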